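import Summits.RiemannHypothesis.RiemannHypothesis.Theorems.Splittings.ScrewLatticeContinuationA
import Mathlib.Topology.Baire.Lemmas
import Mathlib.Topology.Baire.CompleteMetrizable

/-!
# `CEIL` on a continuum of steps is the Riemann hypothesis (barrier B23 «CEIL-CONTINUUM», tree locator)

`CEIL(h) := LatticeCeiling h` (`ScrewLatticeContinuationA`) is the two-sided sub-exponential growth of
the lattice samples `Ψ(k h)`, `k ∈ ℕ`, of Suzuki's screw function `Ψ = zetaScrew`. A single lattice is
blind (barrier B16, `ScrewLatticeBlindModel`), but a set of steps with non-empty interior is not: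

* `riemannHypothesis_of_ceil_on_Icc` : `CEIL(h)` for every `h ∈ [a, b]`, `0 < a < b`, implies
  `RiemannHypothesis`;
* `riemannHypothesis_of_ceil_small` : `CEIL(h)` for every `h ∈ (0, δ)` implies `RiemannHypothesis`;
* `ceilAll_iff_rh` : `(∀ h > 0, CEIL(h)) ↔ RiemannHypothesis` (criterion T28 of the rh-split cell;
  the converse direction is `latticeCeiling_of_rh`);
* `summit_of_ceilAll` : the same hypothesis gives the summit constant `Summit.RiemannHypothesis`.

Proof. (1) Baire in the step: for fixed `ε` the sets `{h ∈ [a,b] : ∀ k, |Ψ(kh)| ≤ N e^{εk}}` are closed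
(`continuous_zetaScrew`) and cover the complete space `[a,b]`, so one of them contains an interval
`[h₁, h₂]` (`exists_uniform_of_ceil_on_Icc`). (2) Covering by dilates (Croft 1957 / Kingman 1963):
`⋃ₖ k·[h₁,h₂] ⊇ [T₀, ∞)`, whence `|Ψ(t)| ≤ N e^{(ε/h₁) t}` for `t ≥ T₀` (`abs_le_of_uniform_on_Icc`) and,
with `ε := η a`, two-sided sub-exponential growth `SubexpGrowth` (`subexpGrowth_of_ceil_on_Icc`).
(3) Mellin side: the bound makes `Ψ(log x) x^{-(σ+1)}` integrable on `(1, ∞)` for every `σ > η`, so the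
transform is holomorphic on `Re s > η` (`Landau.differentiableOn_mellinIoi_of_forall`); the identity
theorem and the order-of-vanishing comparison of `ZetaScrewLandau.riemannXi_ne_zero_of_zetaScrew_nonneg`
exclude zeros of `ξ(1/2 + w)` with `Re w > η` (`riemannXi_ne_zero_of_subexp`); `η → 0⁺` gives RH via
`quasiRiemannHypothesis_one_half_iff_holds` (`riemannHypothesis_of_subexp`).

Sorry-free, standard axioms, no instances, no notation. Source: rh-split cell, theory-1 g11 kernel
T28CeilAllRH.lean (sha16 db1a45a11463cbbc), second check ref-2 g5 (8457384027608ef1); RULING #291.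
-/

set_option linter.dupNamespace false

noncomputable section

open Complex Filter Topology Set MeasureTheory
open scoped Real

namespace Summit.RiemannHypothesis.RiemannHypothesis.Theorems.Splittings.ScrewCeilContinuum

open Literature.NumberTheory.LFunctions
open Literature.NumberTheory.LFunctions.ZetaScrewLandau
open Summit.RiemannHypothesis.RiemannHypothesis.Theorems.Splittings.ScrewLatticeContinuation

/-- Two-sided sub-exponential growth of `Ψ` on `[0, ∞)`: `|Ψ(t)| ≤ N_η e^{η t}` for every `η > 0`. -/
def SubexpGrowth : Prop :=
  ∀ η : ℝ, 0 < η → ∃ N : ℝ, ∀ t : ℝ, 0 ≤ t → |zetaScrew t| ≤ N * Real.exp (η * t)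

/-! ### (3) Sub-exponential growth excludes zeros off the line -/

/-- Under `SubexpGrowth`, the Mellin integrand `Ψ(log x) x^{-(σ+1)}` is integrable on `(1, ∞)` for
every `σ > η > 0`. -/
theorem integrableOn_of_subexp (hΨ : SubexpGrowth) {η σ : ℝ} (hη : 0 < η) (hσ : η < σ) :
    IntegrableOn (fun x : ℝ ↦ zetaScrew (Real.log x) * x ^ (-(σ + 1))) (Ioi 1) := by
  obtain ⟨N, hN⟩ := hΨ η hη
  have hmeas : AEStronglyMeasurable (fun x : ℝ ↦ zetaScrew (Real.log x) * x ^ (-(σ + 1)))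
      (volume.restrict (Ioi 1)) :=
    ((continuous_zetaScrew.measurable.comp Real.measurable_log).mul
      (measurable_id.pow_const _)).aestronglyMeasurable
  have hint : IntegrableOn (fun x : ℝ ↦ N * x ^ (η - (σ + 1))) (Ioi 1) :=
    (integrableOn_Ioi_rpow_of_lt (by linarith) zero_lt_one).const_mul N
  refine hint.mono' hmeas ((ae_restrict_iff' measurableSet_Ioi).2 (Eventually.of_forall ?_))
  intro x hx
  have hx1 : 1 < x := hx
  have hx : 0 < x := zero_lt_one.trans hx1
  have hlog : 0 ≤ Real.log x := Real.log_nonneg hx1.le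
  have h1 : |zetaScrew (Real.log x)| ≤ N * x ^ η := by
    have := hN (Real.log x) hlog
    rwa [Real.rpow_def_of_pos hx, mul_comm (Real.log x)]
  have hpow : 0 ≤ x ^ (-(σ + 1)) := Real.rpow_nonneg hx.le _
  calc ‖zetaScrew (Real.log x) * x ^ (-(σ + 1))‖
      = |zetaScrew (Real.log x)| * x ^ (-(σ + 1)) := by
        rw [norm_mul, Real.norm_eq_abs, Real.norm_of_nonneg hpow]
    _ ≤ N * x ^ η * x ^ (-(σ + 1)) := mul_le_mul_of_nonneg_right h1 hpow
    _ = N * x ^ (η - (σ + 1)) := by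
        rw [sub_eq_add_neg, Real.rpow_add hx]; ring

/-- **No zeros of `ξ(1/2 + ·)` in `Re w > 0` under two-sided sub-exponential growth of `Ψ`.**
The identity-theorem half of `ZetaScrewLandau.riemannXi_ne_zero_of_zetaScrew_nonneg`, with the
Landau step replaced by absolute convergence read off the growth bound. -/
theorem riemannXi_ne_zero_of_subexp (hΨ : SubexpGrowth) {w₀ : ℂ} (hw₀ : 0 < w₀.re) :
    riemannXi (1 / 2 + w₀) ≠ 0 := by
  intro hzero
  set g : ℝ → ℝ := fun x ↦ zetaScrew (Real.log x) with hg_def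
  have hg : Measurable g := continuous_zetaScrew.measurable.comp Real.measurable_log
  set R : ℂ → ℂ := fun s ↦ 1 / s ^ 2 * logDeriv riemannXi (1 / 2 + s) with hR_def
  set ε : ℝ := min (w₀.re / 2) 1 with hε_def
  have hε : 0 < ε := lt_min (by positivity) one_pos
  have hεw : ε < w₀.re := (min_le_left _ _).trans_lt (by linarith)
  have hε2 : ε < 2 := (min_le_right _ _).trans_lt (by norm_num)
  have hagree : EqOn R (Landau.mellinIoi g) {s : ℂ | 1 < s.re} := by
    intro s hs
    simp only [Set.mem_setOf_eq] at hs
    exact (mellinIoi_eq_of_re_gt (by linarith)).symm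
  -- absolute convergence for every `σ > ε`, read off the growth bound (no Landau lemma needed)
  have hS : ∀ σ' : ℝ, ε < σ' → IntegrableOn (fun x ↦ g x * x ^ (-(σ' + 1))) (Ioi 1) :=
    fun σ' hσ' ↦ integrableOn_of_subexp hΨ hε hσ'
  set F : ℂ → ℂ := Landau.mellinIoi g with hF_def
  have hFdiff : DifferentiableOn ℂ F {s : ℂ | ε < s.re} :=
    Landau.differentiableOn_mellinIoi_of_forall hg hS
  set H : Set ℂ := {s : ℂ | ε < s.re} with hH_def
  have hHo : IsOpen H := isOpen_lt continuous_const Complex.continuous_re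
  have hHpre : IsPreconnected H := (convex_halfSpace_re_gt ε).isPreconnected
  -- the identity `F(s) s² ξ(1/2+s) = ξ'(1/2+s)` on `H`
  set Z : ℂ → ℂ := fun s ↦ riemannXi (1 / 2 + s) with hZ_def
  have hZd : Differentiable ℂ Z := differentiable_riemannXi.comp (by fun_prop)
  have hZa : ∀ s, AnalyticAt ℂ Z s := fun s ↦ hZd.analyticAt s
  have hderivZ : ∀ s, deriv Z s = deriv riemannXi (1 / 2 + s) := fun s ↦ by
    simp only [hZ_def]
    exact deriv_comp_const_add riemannXi (1 / 2) s
  set G : ℂ → ℂ := fun s ↦ F s * s ^ 2 with hG_def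
  have hGa : ∀ s ∈ H, AnalyticAt ℂ G s := fun s hs ↦
    ((hFdiff.analyticOnNhd hHo) s hs).mul ((analyticAt_id.pow 2))
  have hf₁ : AnalyticOnNhd ℂ (G * Z) H := fun s hs ↦ (hGa s hs).mul (hZa s)
  have hf₂ : AnalyticOnNhd ℂ (deriv Z) H := fun s _ ↦ (hZa s).deriv
  have h2H : (2 : ℂ) ∈ H := by
    simp only [hH_def, Set.mem_setOf_eq]
    norm_num
    linarith
  have hev2 : (G * Z) =ᶠ[𝓝 (2 : ℂ)] deriv Z := by
    have hopen : IsOpen {s : ℂ | 1 < s.re} := isOpen_lt continuous_const Complex.continuous_re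
    filter_upwards [hopen.mem_nhds (show (2 : ℂ) ∈ {s : ℂ | 1 < s.re} by simp)] with s hs
    have hs' : 1 < s.re := hs
    have hξ : riemannXi (1 / 2 + s) ≠ 0 := riemannXi_ne_zero_of_one_le_re (by simp; linarith)
    have hs0 : s ≠ 0 := fun h ↦ by rw [h, zero_re] at hs'; linarith
    rw [Pi.mul_apply, hderivZ s]
    simp only [hG_def, hZ_def]
    rw [← hagree hs]
    simp only [hR_def]
    rw [logDeriv_apply]
    set A : ℂ := deriv riemannXi (1 / 2 + s)
    set B : ℂ := riemannXi (1 / 2 + s)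
    field_simp
  have hEqOn : EqOn (G * Z) (deriv Z) H := hf₁.eqOn_of_preconnected_of_eventuallyEq hf₂ hHpre h2H hev2
  -- orders at `w₀`
  have hw₀H : w₀ ∈ H := by
    simp only [hH_def, Set.mem_setOf_eq]
    exact hεw
  have hev : deriv Z =ᶠ[𝓝 w₀] G * Z := by
    filter_upwards [hHo.mem_nhds hw₀H] with s hs
    exact (hEqOn hs).symm
  have hZ0 : Z w₀ = 0 := hzero
  have h1 : analyticOrderAt (deriv Z) w₀ + 1 = analyticOrderAt Z w₀ := by
    have := (hZa w₀).analyticOrderAt_deriv_add_one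
    simpa [hZ0] using this
  have h2 : analyticOrderAt (deriv Z) w₀ = analyticOrderAt G w₀ + analyticOrderAt Z w₀ := by
    rw [analyticOrderAt_congr hev, analyticOrderAt_mul (hGa w₀ hw₀H) (hZa w₀)]
  rw [h2] at h1
  -- `Z` is not locally zero (else `ξ ≡ 0`), so its order is finite, contradiction
  generalize hoZ : analyticOrderAt Z w₀ = oZ at h1
  generalize hoG : analyticOrderAt G w₀ = oG at h1
  cases oZ with
  | top =>
    have hloc : ∀ᶠ s in 𝓝 w₀, Z s = 0 := analyticOrderAt_eq_top.1 hoZ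
    have hall : EqOn Z 0 univ :=
      (hZd.differentiableOn.analyticOnNhd isOpen_univ).eqOn_zero_of_preconnected_of_eventuallyEq_zero
        isPreconnected_univ (Set.mem_univ w₀) hloc
    have h1' : Z 1 = 0 := hall (Set.mem_univ 1)
    simp only [hZ_def] at h1'
    exact riemannXi_ne_zero_of_one_le_re (s := 1 / 2 + 1) (by norm_num) h1'
  | coe n =>
    cases oG with
    | top => simp at h1
    | coe m =>
      have h' : (m + n + 1 : ℕ) = n := by exact_mod_cast h1
      omega

/-- **Two-sided sub-exponential growth of `Ψ` implies the Riemann hypothesis** (pattern of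
`riemannHypothesis_of_zetaScrew_nonneg`). -/
theorem riemannHypothesis_of_subexp (hΨ : SubexpGrowth) : RiemannHypothesis := by
  refine quasiRiemannHypothesis_one_half_iff_holds.1 fun s hs h1 h2 ↦ ?_
  have hξ : riemannXi s = 0 := (riemannXi_eq_zero_iff_holds s).2 ⟨hs, by linarith, h2⟩
  have hw : 0 < (s - 1 / 2).re := by simp; linarith
  refine riemannXi_ne_zero_of_subexp hΨ hw ?_
  rw [show (1 / 2 : ℂ) + (s - 1 / 2) = s by ring]
  exact hξ

/-! ### (2) Covering: a uniform ceiling on an interval of steps bounds `Ψ` on a half-line -/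

/-- If `|Ψ(k h)| ≤ N e^{ε k}` for all `k ∈ ℕ` and all steps `h ∈ [h₁, h₂]` (`0 < h₁ < h₂`), then
`|Ψ(t)| ≤ N e^{(ε/h₁) t}` for all `t ≥ T₀`: every large `t` is `k · h` with `h ∈ [h₁, h₂]`,
`k = ⌊t/h₁⌋`. -/
theorem abs_le_of_uniform_on_Icc {h₁ h₂ N ε : ℝ} (h1 : 0 < h₁) (h12 : h₁ < h₂) (hε : 0 ≤ ε)
    (hU : ∀ h ∈ Icc h₁ h₂, ∀ k : ℕ, |zetaScrew (k * h)| ≤ N * Real.exp (ε * k)) :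
    ∃ T₀ : ℝ, ∀ t : ℝ, T₀ ≤ t → |zetaScrew t| ≤ N * Real.exp (ε / h₁ * t) := by
  have hN : 0 ≤ N := by
    have := hU h₁ ⟨le_rfl, h12.le⟩ 0
    simp only [Nat.cast_zero, zero_mul, mul_zero, Real.exp_zero, mul_one] at this
    exact (abs_nonneg _).trans this
  set k₀ : ℕ := ⌈h₁ / (h₂ - h₁)⌉₊ + 1 with hk₀_def
  refine ⟨k₀ * h₁, fun t ht ↦ ?_⟩
  have hd : 0 < h₂ - h₁ := sub_pos.2 h12
  have ht0 : 0 ≤ t := le_trans (by positivity) ht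
  have hth : (k₀ : ℝ) ≤ t / h₁ := by rwa [le_div_iff₀ h1]
  set k : ℕ := ⌊t / h₁⌋₊ with hk_def
  have hk₀k : k₀ ≤ k := Nat.le_floor hth
  have hkle : (k : ℝ) ≤ t / h₁ := Nat.floor_le (div_nonneg ht0 h1.le)
  have hklt : t / h₁ < k + 1 := Nat.lt_floor_add_one _
  have hk1 : 1 ≤ k := le_trans (Nat.le_add_left 1 _) hk₀k
  have hkpos : (0 : ℝ) < k := by exact_mod_cast hk1
  -- `k (h₂ - h₁) > h₁`, from `k ≥ k₀ > h₁ / (h₂ - h₁)`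
  have hkbig : h₁ < k * (h₂ - h₁) := by
    have h' : h₁ / (h₂ - h₁) < k₀ := by
      have := Nat.le_ceil (h₁ / (h₂ - h₁))
      rw [hk₀_def]; push_cast; linarith
    have h'' : h₁ / (h₂ - h₁) < k := h'.trans_le (by exact_mod_cast hk₀k)
    rwa [div_lt_iff₀ hd] at h''
  -- the step `h = t / k ∈ [h₁, h₂]`
  have hmem : t / k ∈ Icc h₁ h₂ := by
    constructor
    · rw [le_div_iff₀ hkpos]
      have := (le_div_iff₀ h1).1 hkle
      linarith
    · rw [div_le_iff₀ hkpos]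
      have := (div_lt_iff₀ h1).1 hklt
      nlinarith
  have hprod : (k : ℝ) * (t / k) = t := by field_simp
  have hbound := hU (t / k) hmem k
  rw [hprod] at hbound
  refine hbound.trans (mul_le_mul_of_nonneg_left (Real.exp_le_exp.2 ?_) hN)
  -- `ε k ≤ (ε / h₁) t` since `k ≤ t / h₁`
  have : ε * k ≤ ε * (t / h₁) := mul_le_mul_of_nonneg_left hkle hε
  calc ε * k ≤ ε * (t / h₁) := this
    _ = ε / h₁ * t := by ring

/-! ### (1) Baire in the step -/

/-- If `CEIL(h)` holds for every step `h ∈ [a, b]` (`a < b`), then for every `ε > 0` some sub-interval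
`[h₁, h₂] ⊆ [a, b]` carries a UNIFORM ceiling `|Ψ(k h)| ≤ N e^{ε k}` (Baire category in the complete
space `[a, b]`; the sets in question are closed by continuity of `Ψ`). -/
theorem exists_uniform_of_ceil_on_Icc {a b : ℝ} (hab : a < b)
    (hC : ∀ h ∈ Icc a b, LatticeCeiling h) {ε : ℝ} (hε : 0 < ε) :
    ∃ h₁ h₂ N : ℝ, a ≤ h₁ ∧ h₁ < h₂ ∧ h₂ ≤ b ∧
      ∀ h ∈ Icc h₁ h₂, ∀ k : ℕ, |zetaScrew (k * h)| ≤ N * Real.exp (ε * k) := by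
  haveI : CompleteSpace (Icc a b) := isClosed_Icc.completeSpace_coe
  haveI : Nonempty (Icc a b) := ⟨⟨a, left_mem_Icc.2 hab.le⟩⟩
  set f : ℕ → Set (Icc a b) :=
    fun N ↦ {x | ∀ k : ℕ, |zetaScrew (k * (x : ℝ))| ≤ N * Real.exp (ε * k)} with hf_def
  have hclosed : ∀ N, IsClosed (f N) := by
    intro N
    have hfN : f N = ⋂ k : ℕ, {x : Icc a b | |zetaScrew (k * (x : ℝ))| ≤ N * Real.exp (ε * k)} := by
      ext x; simp [hf_def]
    rw [hfN]
    refine isClosed_iInter fun k ↦ isClosed_le ?_ continuous_const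
    exact continuous_abs.comp
      (continuous_zetaScrew.comp (continuous_const.mul continuous_subtype_val))
  have hcover : ⋃ N, f N = univ := by
    refine Set.eq_univ_of_forall fun x ↦ ?_
    obtain ⟨K, hK⟩ := hC x x.2 ε hε
    refine Set.mem_iUnion.2 ⟨⌈K⌉₊, fun k ↦ (hK k).trans ?_⟩
    exact mul_le_mul_of_nonneg_right (Nat.le_ceil K) (Real.exp_pos _).le
  obtain ⟨N, hN⟩ := nonempty_interior_of_iUnion_of_closed hclosed hcover
  obtain ⟨x, hx⟩ := hN
  obtain ⟨r, hr, hball⟩ := Metric.mem_nhds_iff.1 (mem_interior_iff_mem_nhds.1 hx)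
  have hxa : a ≤ (x : ℝ) := x.2.1
  have hxb : (x : ℝ) ≤ b := x.2.2
  refine ⟨max a (x - r / 2), min b (x + r / 2), N, le_max_left _ _, ?_, min_le_left _ _, ?_⟩
  · exact max_lt (lt_min hab (by linarith)) (lt_min (by linarith) (by linarith))
  · intro h hh k
    have hlo := le_max_right a ((x : ℝ) - r / 2)
    have hhi := min_le_right b ((x : ℝ) + r / 2)
    have hloa := le_max_left a ((x : ℝ) - r / 2)
    have hhib := min_le_left b ((x : ℝ) + r / 2)
    have hmem : h ∈ Icc a b := ⟨hloa.trans hh.1, hh.2.trans hhib⟩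
    have hy : (⟨h, hmem⟩ : Icc a b) ∈ Metric.ball x r := by
      rw [Metric.mem_ball, Subtype.dist_eq, Real.dist_eq, abs_lt]
      constructor <;> push_cast <;> linarith [hh.1, hh.2]
    exact hball hy k

/-- `CEIL` on an interval of steps `[a, b]`, `0 < a < b`, gives two-sided sub-exponential growth of
`Ψ` on `[0, ∞)`. -/
theorem subexpGrowth_of_ceil_on_Icc {a b : ℝ} (ha : 0 < a) (hab : a < b)
    (hC : ∀ h ∈ Icc a b, LatticeCeiling h) : SubexpGrowth := by
  intro η hη
  obtain ⟨h₁, h₂, N, ha1, h12, _, hU⟩ := exists_uniform_of_ceil_on_Icc hab hC (mul_pos hη ha)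
  have h1pos : 0 < h₁ := ha.trans_le ha1
  obtain ⟨T₀, hT⟩ := abs_le_of_uniform_on_Icc h1pos h12 (mul_pos hη ha).le hU
  obtain ⟨M, hM⟩ := (isCompact_Icc (a := (0 : ℝ)) (b := T₀)).exists_bound_of_continuousOn
    continuous_zetaScrew.continuousOn
  have hN : 0 ≤ N := by
    have := hU h₁ ⟨le_rfl, h12.le⟩ 0
    simp only [Nat.cast_zero, zero_mul, mul_zero, Real.exp_zero, mul_one] at this
    exact (abs_nonneg _).trans this
  refine ⟨N + max M 0, fun t ht ↦ ?_⟩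
  have hexp1 : 1 ≤ Real.exp (η * t) := Real.one_le_exp (by positivity)
  have hM0 : 0 ≤ max M 0 := le_max_right _ _
  by_cases hTt : T₀ ≤ t
  · have hrate : η * a / h₁ * t ≤ η * t := by
      have : η * a / h₁ ≤ η := by
        rw [div_le_iff₀ h1pos]
        exact mul_le_mul_of_nonneg_left ha1 hη.le
      exact mul_le_mul_of_nonneg_right this ht
    calc |zetaScrew t| ≤ N * Real.exp (η * a / h₁ * t) := hT t hTt
      _ ≤ N * Real.exp (η * t) := mul_le_mul_of_nonneg_left (Real.exp_le_exp.2 hrate) hN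
      _ ≤ (N + max M 0) * Real.exp (η * t) := by
          have := Real.exp_pos (η * t)
          nlinarith
  · have hTt' : t < T₀ := not_le.1 hTt
    have hmem : t ∈ Icc (0 : ℝ) T₀ := ⟨ht, hTt'.le⟩
    have hMt : |zetaScrew t| ≤ max M 0 :=
      ((Real.norm_eq_abs _).symm.le.trans (hM t hmem)).trans (le_max_left _ _)
    calc |zetaScrew t| ≤ max M 0 := hMt
      _ ≤ (N + max M 0) * 1 := by linarith
      _ ≤ (N + max M 0) * Real.exp (η * t) :=
          mul_le_mul_of_nonneg_left hexp1 (by linarith)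

/-! ### The census theorems -/

/-- **`CEIL` on an interval of steps implies RH.** -/
theorem riemannHypothesis_of_ceil_on_Icc {a b : ℝ} (ha : 0 < a) (hab : a < b)
    (hC : ∀ h ∈ Icc a b, LatticeCeiling h) : RiemannHypothesis :=
  riemannHypothesis_of_subexp (subexpGrowth_of_ceil_on_Icc ha hab hC)

/-- **`CEIL` at all steps implies RH.** -/
theorem riemannHypothesis_of_ceilAll (hC : ∀ h : ℝ, 0 < h → LatticeCeiling h) :
    RiemannHypothesis :=
  riemannHypothesis_of_ceil_on_Icc one_pos one_lt_two fun h hh ↦ hC h (one_pos.trans_le hh.1)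

/-- **`(∀ h > 0, CEIL(h)) ↔ RH`** (the converse is `latticeCeiling_of_rh`). -/
theorem ceilAll_iff_rh : (∀ h : ℝ, 0 < h → LatticeCeiling h) ↔ RiemannHypothesis :=
  ⟨riemannHypothesis_of_ceilAll, fun hRH h _ ↦ latticeCeiling_of_rh hRH h⟩

/-- **`CEIL` at all SMALL steps is already RH**: `(∀ h ∈ (0, δ), CEIL(h)) → RH` for any `δ > 0`. -/
theorem riemannHypothesis_of_ceil_small {δ : ℝ} (hδ : 0 < δ)
    (hC : ∀ h : ℝ, 0 < h → h < δ → LatticeCeiling h) : RiemannHypothesis :=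
  riemannHypothesis_of_ceil_on_Icc (a := δ / 3) (b := δ / 2) (by positivity) (by linarith)
    fun h hh ↦ hC h (by linarith [hh.1]) (by linarith [hh.2])

/-- The hypothesis of `ceilAll_iff_rh` — verbatim the residual `CeilAll` of route `ScrewLasso` (item
stmt-RiemannHypothesis-22294) — gives the summit constant `Summit.RiemannHypothesis` (KILLS §K X-13,
RULING #289: that conjunct alone decides the route). -/
theorem summit_of_ceilAll (h₄ : ∀ h : ℝ, 0 < h → LatticeCeiling h) :
    Summit.RiemannHypothesis :=
  riemannHypothesis_of_ceilAll h₄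

end Summit.RiemannHypothesis.RiemannHypothesis.Theorems.Splittings.ScrewCeilContinuum
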